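import Summits.ResolutionOfSingularities.ResolutionOfSingularities.Theorems.FrobeniusClosingSteerWords18HeightVocab
import Summits.ResolutionOfSingularities.ResolutionOfSingularities.Theorems.FrobeniusClosingSteerWords17BNormalStartSlates
import Summits.ResolutionOfSingularities.ResolutionOfSingularities.Theorems.FrobeniusClosingSteerThreadKoenig
import Summits.ResolutionOfSingularities.ResolutionOfSingularities.Theorems.FrobeniusClosingSteerStrippedChainTwoOfLipman
import Literature.AlgebraicGeometry.Resolution.LipmanNoEternalNormalisedBranchProofs
import Literature.AlgebraicGeometry.Resolution.LipmanValuativeOfNormalisedBranch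

/-!
# Crux `Steer` (stmt-ResolutionOfSingularities-16345), line `switching-dichotomy` — WORDS 19: §σ2.25 v2 (3) THE LOCALISED GRADED KÖNIG AND THE HEIGHT-SPLIT ASSEMBLY (res-D-pv-003: `wanderForestKoenig_graded`, `highWanderConclTwoN_of_heightSplit`, the slate2/3/4/5/6 T-lines of r31–r33) (HOIST of the registered skeleton r49 bb092f8f650aca19, l.828–1094, inside `section HeightSplitTwo` with its `variable {K : Type} [Field K]`)

Holder res-L0-w41-lead-1 g6 on res-L0-w41-plan-1 RULING 47 (E1) / 104b; see `…Words01Core` for the hoist protocol (bodies byte for byte;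
`[cite: …]` / `[folklore]` tags on CLOSED `def … : Prop` words are written «(ref. …)» / «(folklore)» — GATE NOTE of `…Words02Stubs`;
cite keys inside `[cite:]` tags normalised to `references.bib` keys where needed, as in `…Words03Phases`).
Nothing here is a statement of the manuscript [claim: Hironaka2017, status: under-review]. OURS (candidates / vocabulary; AI review is
weaker than expert review).
-/

open Summit.ResolutionOfSingularities.ResolutionOfSingularities.Theses.FrobeniusClosing (IsolatedForcedTermination)
open Literature.AlgebraicGeometry.Resolution (IsAbhyankarPlace FGOver exists_ringKrullDim_eq_and_trdeg_eq
  trdeg_eq_trdeg_of_isFractionRing locAtCentre IsQuadraticTransformAlong SubringDominates IsRsopPart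
  LocalUniformization3 RelLocalUniformization CossartPiltant2019General)
open Summit.ResolutionOfSingularities.ResolutionOfSingularities.Theorems.SteerRankThinness
  (HasProperCoarsening concl_of_hasProperCoarsening rankOne_of_not_hasProperCoarsening)
open Summit.ResolutionOfSingularities.ResolutionOfSingularities.Theorems.PfaffLine

set_option linter.dupNamespace false

namespace Summit.ResolutionOfSingularities.ResolutionOfSingularities.Theorems.SwitchingDichotomy.Words

section SteeredTwo

open IsLocalRing
open Literature.AlgebraicGeometry.Resolution (IsLocalBlowupAlong IsQuadraticTransform IsExcellentRing)

variable {K : Type} [Field K]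


/-! #### §σ2.25 v2 (3) — the localised graded König and the height-split assembly (kernel-checked) -/

/-- **Pigeonhole over finitely many heights** (pure combinatorics, PROVED): an infinite set on which an `ℕ∞`-valued function is `< n` has an
infinite fibre at some natural number `h' < n`. OURS. [folklore] -/
theorem exists_fibre_infinite_of_lt {ι : Type} (f : ι → ℕ∞) (n : ℕ) {T : Set ι} (hT : T.Infinite)
    (hlt : ∀ m ∈ T, f m < n) : ∃ h' : ℕ, h' < n ∧ {m | m ∈ T ∧ f m = h'}.Infinite := by
  by_contra hno
  have hfin : ∀ h' : ℕ, h' < n → {m | m ∈ T ∧ f m = h'}.Finite :=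
    fun h' hh' => Set.not_infinite.mp fun hi => hno ⟨h', hh', hi⟩
  apply hT
  have hU : (⋃ h' ∈ (↑(Finset.range n) : Set ℕ), {m | m ∈ T ∧ f m = h'}).Finite :=
    Set.Finite.biUnion (Finset.range n).finite_toSet fun h' hh' =>
      hfin h' (Finset.mem_range.mp (Finset.mem_coe.mp hh'))
  refine hU.subset fun m hm => ?_
  obtain ⟨h', hh'⟩ := ENat.ne_top_iff_exists.mp (hlt m hm).ne_top
  have hh'n : h' < n := by
    have h1 := hlt m hm
    rw [← hh'] at h1
    exact_mod_cast h1
  exact Set.mem_biUnion (Finset.mem_coe.mpr (Finset.mem_range.mpr hh'n)) ⟨hm, hh'.symm⟩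

/-- **LOCALISED GRADED KÖNIG** (PROVED; plan-1 RULING 25 (i), tri-2 (W2)): infinitely many positive steps of ONE height `h`, finitely many births
OF HEIGHT `h` and finite branching AT PARENTS OF HEIGHT `h` force an infinite thread of height `h` — roots / branching at other heights (e.g. the
height-1 strippings) are irrelevant. Same `koenig_nat` call as `wanderForestKoenig_graded` with `S = {positive steps of height h}`,
`A i j = ancestry ∧ ht (P j) = h`; graded roots are height-`h` roots, graded children of a height-`h` parent are children, and a parent of height
`≠ h` has NO graded children (ancestry preserves the height). OURS. [folklore] -/
theorem wanderForestKoenig_graded' (R : ℕ → Subring K) (P : (i : ℕ) → Ideal (R i)) (hmono : Monotone R) (h : ℕ∞)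
    (hinf : {j | IsPosStep R P j ∧ (P j).height = h}.Infinite)
    (hroots : {j | IsRootStep R P j ∧ (P j).height = h}.Finite)
    (hbr : ∀ i, (P i).height = h → {j | IsChildStep R P i j}.Finite) :
    ∃ J : Set ℕ, J.Infinite ∧ (∀ i ∈ J, ∀ j ∈ J, i < j → IsAncestorStep R P i j) ∧ ∀ j ∈ J, (P j).height = h := by
  classical
  obtain ⟨J, hJ, hA⟩ := _root_.Summit.ResolutionOfSingularities.ResolutionOfSingularities.Theorems.SwitchingDichotomy.ThreadChain.koenig_nat (A := fun i j => IsAncestorStep R P i j ∧ (P j).height = h)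
    (S := {j | IsPosStep R P j ∧ (P j).height = h})
    (fun hij => hij.1.1)
    (fun hij => ⟨hij.1.2.1, hij.1.2.2.2.1.symm.trans hij.2⟩)
    (fun h₁ h₂ => ⟨isAncestorStep_trans R P h₁.1 h₂.1, h₂.2⟩)
    (fun hij h₁ h₂ => ⟨isAncestorStep_of_common_descendant R P hmono hij h₁.1 h₂.1, h₂.1.2.2.2.1.symm.trans h₂.2⟩)
    hinf
    (hroots.subset fun j hj => ⟨⟨hj.1.1, fun i hi => hj.2 i ⟨hi, hj.1.2⟩⟩, hj.1.2⟩)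
    (fun i => by
      by_cases hi : (P i).height = h
      · exact (hbr i hi).subset fun j hj => ⟨hj.1.1, fun k hk => hj.2 k ⟨hk, hj.1.2⟩⟩
      · refine Set.finite_empty.subset ?_
        rintro j ⟨⟨hanc, hjh⟩, -⟩
        exact hi (hanc.2.2.2.1.symm.trans hjh))
  refine ⟨J, hJ, fun i hi j hj hij => (hA i hi j hj hij).1, fun j hj => ?_⟩
  obtain ⟨l, hl, hjl⟩ := hJ.exists_gt j
  obtain ⟨hanc, hlh⟩ := hA j hj l hl hjl
  exact hanc.2.2.2.1.symm.trans hlh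

/-- **THE HEIGHT SPLIT v2 — kernel** (PROVED; plan-1 RULING 25 (ii)): `HighWanderConclTwoN` ⇐ F-B + F-A1 + F-A2 + F-A3 + T-i + Θ2 + K(1..3) +
K♭(2), K♭(3). Positive steps are infinite (`hio`). If only finitely many have height `≥ 2`: F-B. Else, if the height-`≥ 2` roots are infinite: F-A1;
if some height-`≥ 2` parent branches infinitely: F-A2. Otherwise EXFALSO by strong induction on the height `h ≥ 2` carrying infinitely many
positive steps (pigeonhole: Θ2 (a) bounds heights by 3): localised graded König gives an infinite thread `J` of height `h`; `J` finitely hit ⇒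
T-i ⇒ `¬ K(c)`, absurd; `J` infinitely hit but finitely hit in height `≥ 2` ⇒ F-A3 ⇒ `¬ K♭(c)`, `c ∈ {2,3}`, absurd; `J` infinitely hit in height
`≥ 2` ⇒ those hits are positive steps of height in `[2, h)` (Θ2 (b)), an infinite set ⇒ pigeonhole ⇒ a smaller height `h' ≥ 2` with infinitely
many positive steps ⇒ induction. OURS. [folklore] -/
theorem highWanderConclTwoN_of_heightSplit (hS : StrippingTailHighConclTwoN) (hB₂ : BirthWanderHighConclTwoN)
    (hC₂ : BranchWanderHighConclTwoN) (hA3 : StrippedThreadTwoN) (hTi : FinitelyHitThreadTwoN) (hH : HitHeightLtTwoN)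
    (hK1 : ∀ p : ℕ, p.Prime → NoEternalIsolatedRadicandChain p 1)
    (hK2 : ∀ p : ℕ, p.Prime → NoEternalIsolatedRadicandChain p 2)
    (hK3 : ∀ p : ℕ, p.Prime → NoEternalIsolatedRadicandChain p 3)
    (hS2 : ∀ p : ℕ, p.Prime → NoEternalStrippedRadicandChain p 2)
    (hS3 : ∀ p : ℕ, p.Prime → NoEternalStrippedRadicandChain p 3) : HighWanderConclTwoN := by
  intro p hp2 k K _i1 _i2 _i3 _i4 _i5 O A₀ h₀ t core hrk R P s hR0 hN hrun hnd hio hhigh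
  have hp : p.Prime := hp2 ▸ Nat.prime_two
  -- infinitely many positive steps
  have hinf : {j | IsPosStep R P j}.Infinite := by
    refine Set.infinite_of_not_bddAbove ?_
    rintro ⟨b, hb'⟩
    obtain ⟨i, hi, hnp⟩ := hio (b + 1)
    obtain ⟨hl, -⟩ := hrun.2 i
    have := hb' (show i ∈ {j | IsPosStep R P j} from ⟨hl, fun h => hnp ⟨hl, h⟩⟩)
    omega
  by_cases h2 : HeightTwoStepsInfinite R P
  swap
  · exact hS p hp2 k K O A₀ h₀ t core hrk R P s hR0 hN hrun hnd hhigh h2 hinf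
  by_cases hb : {j | IsRootStep R P j ∧ 2 ≤ (P j).height}.Infinite
  · exact hB₂ p hp2 k K O A₀ h₀ t core hrk R P s hR0 hN hrun hnd hhigh hb
  by_cases hc : ∃ i, 2 ≤ (P i).height ∧ {j | IsChildStep R P i j}.Infinite
  · exact hC₂ p hp2 k K O A₀ h₀ t core hrk R P s hR0 hN hrun hnd hhigh hc
  exfalso
  have hroots : {j | IsRootStep R P j ∧ 2 ≤ (P j).height}.Finite := Set.not_infinite.mp hb
  have hbr : ∀ i, 2 ≤ (P i).height → {j | IsChildStep R P i j}.Finite := fun i hi =>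
    Set.not_infinite.mp fun h => hc ⟨i, hi, h⟩
  have hmono : Monotone R := hrun.monotone
  obtain ⟨hle3, hhit⟩ := hH p hp2 k K O A₀ h₀ t core hrk R P s hR0 hN hrun
  -- descent on the height `h ≥ 2` carrying infinitely many positive steps
  have main : ∀ h : ℕ, 2 ≤ h → {j | IsPosStep R P j ∧ (P j).height = (h : ℕ∞)}.Infinite → False := by
    intro h
    induction h using Nat.strong_induction_on with
    | _ h ih =>
      intro h2le hinfh
      have h2le' : (2 : ℕ∞) ≤ (h : ℕ∞) := by exact_mod_cast h2le
      -- localised graded König at height `h`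
      obtain ⟨J, hJ, hA, hh⟩ := wanderForestKoenig_graded' R P hmono h hinfh
        (hroots.subset fun j hj => ⟨hj.1, by rw [Set.mem_setOf_eq] at hj; rw [hj.2]; exact h2le'⟩)
        (fun i hi => hbr i (by rw [hi]; exact h2le'))
      have hJ2 : ∀ j ∈ J, 2 ≤ (P j).height := fun j hj => by rw [hh j hj]; exact h2le'
      by_cases hfin : IsFinitelyHit R P J
      · obtain ⟨c, hc1, hc3, hK⟩ := hTi p hp2 k K O A₀ h₀ t core hrk R P s hR0 hN hrun J hJ hA hfin
        interval_cases c
        · exact hK (hK1 p hp)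
        · exact hK (hK2 p hp)
        · exact hK (hK3 p hp)
      by_cases hfin2 : IsFinitelyHitTwo R P J
      · obtain ⟨c, hc2, hc3, hK⟩ :=
          hA3 p hp2 k K O A₀ h₀ t core hrk R P s hR0 hN hrun hnd hhigh J hJ hA hJ2 hfin2 hfin
        interval_cases c
        · exact hK (hS2 p hp)
        · exact hK (hS3 p hp)
      -- infinitely many hits of height `≥ 2`: positive steps of height in `[2, h)`
      obtain ⟨j₀, hj₀⟩ := hJ.nonempty
      have hH' : {m | IsPosStep R P m ∧ 2 ≤ (P m).height ∧ (P m).height < (h : ℕ∞)}.Infinite := by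
        refine Set.infinite_of_not_bddAbove ?_
        rintro ⟨b, hb⟩
        apply hfin2
        refine ⟨max b j₀ + 1, fun m hm _ j hj hmj => ?_⟩
        have hj₀m : j₀ < m := by omega
        have hA₀ : IsAncestorStep R P j₀ j := hA j₀ hj₀ j hj (lt_trans hj₀m hmj.1.1)
        obtain ⟨hpos, hlt⟩ := hhit j₀ m j hA₀ hj₀m hmj.1
        have hmb : m ≤ b := hb ⟨hpos, hmj.2, lt_of_lt_of_eq hlt (hh j hj)⟩
        omega
      obtain ⟨h', hh'n, hinf'⟩ :=
        exists_fibre_infinite_of_lt (fun m => (P m).height) h hH' fun m hm => hm.2.2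
      obtain ⟨m₁, hm₁⟩ := hinf'.nonempty
      have h2' : 2 ≤ h' := by
        have h1 : (2 : ℕ∞) ≤ (h' : ℕ∞) := by
          have h3 := hm₁.1.2.1
          rw [show (P m₁).height = (h' : ℕ∞) from hm₁.2] at h3
          exact h3
        exact_mod_cast h1
      exact ih h' hh'n h2' (hinf'.mono fun m hm => ⟨hm.1.1, hm.2⟩)
  -- start of the descent: pigeonhole on the positive steps of height `≥ 2` (heights `≤ 3 < 4`, Θ2 (a))
  obtain ⟨h₀, -, hinf₀⟩ := exists_fibre_infinite_of_lt (fun m => (P m).height) 4 h2 fun m hm =>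
    lt_of_le_of_lt (hle3 m hm.1) (by exact_mod_cast (by norm_num : (3 : ℕ) < 4))
  obtain ⟨m₁, hm₁⟩ := hinf₀.nonempty
  have h2₀ : 2 ≤ h₀ := by
    have h1 : (2 : ℕ∞) ≤ (h₀ : ℕ∞) := by
      have h3 := hm₁.1.2
      rw [show (P m₁).height = (h₀ : ℕ∞) from hm₁.2] at h3
      exact h3
    exact_mod_cast h1
  exact main h₀ h2₀ (hinf₀.mono fun m hm => ⟨hm.1.1, hm.2⟩)

/-- **THE HEIGHT SPLIT v2 in the debts currency** (plan-1 RULING 25 (iii)): K(1) proved (p500126), K(2) ⇐ Lipman 1978 (branch form), K(3) ⇐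
Cossart–Piltant 2019 Thm 1.5 in the printed shape (§σ2.24), K♭(2) / K♭(3) as hypotheses (res-D-pv-014 / res-type-026 discharge them).
Pure logic. OURS. [folklore] -/
theorem highWanderConclTwoN_of_heightSplit_debts (hS : StrippingTailHighConclTwoN) (hB₂ : BirthWanderHighConclTwoN)
    (hC₂ : BranchWanderHighConclTwoN) (hA3 : StrippedThreadTwoN) (hTi : FinitelyHitThreadTwoN) (hH : HitHeightLtTwoN)
    (hL : Literature.AlgebraicGeometry.Resolution.Lipman1978NoEternalNormalBranch.{0})
    (hCP' : Literature.AlgebraicGeometry.Resolution.CossartPiltant2019LocalPermissible.{0})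
    (hS2 : ∀ p : ℕ, p.Prime → NoEternalStrippedRadicandChain p 2)
    (hS3 : ∀ p : ℕ, p.Prime → NoEternalStrippedRadicandChain p 3) : HighWanderConclTwoN :=
  highWanderConclTwoN_of_heightSplit hS hB₂ hC₂ hA3 hTi hH noEternalIsolatedRadicandChain_one_holds
    (noEternalIsolatedRadicandChain_two_of_lipman hL) (noEternalIsolatedRadicandChain_three_of_CP' hCP') hS2 hS3

/-- **THE T-LINE OF RECORD AFTER §σ2.25 v2** (plan-1 RULING 25 (iv); `eternalSteeredRunTwo_of_slate` with `(hB) (hC)` replaced by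
`(hS) (hB₂) (hC₂) (hA3) (hS2) (hS3)`): T ⇐ (N1) · B4 · T-i · Θ2 · **F-B ∧ F-A1 ∧ F-A2 (FRONTIER)** · F-A3 (funnel) · K♭(2), K♭(3) (debts) · LOWᴺ
(⇐ hLV) · the named facts Lipman 1978 (branch + valuative forms) and Cossart–Piltant 2019 Thm 1.5 (printed shape). Pure logic. OURS. [folklore] -/
theorem eternalSteeredRunTwo_of_slate2 (hN1 : NormalAtGeneratorTwo) (hB4 : NoHeightOneCarrierTwo)
    (hTi : FinitelyHitThreadTwoN) (hH : HitHeightLtTwoN)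
    (hS : StrippingTailHighConclTwoN) (hB₂ : BirthWanderHighConclTwoN) (hC₂ : BranchWanderHighConclTwoN)
    (hA3 : StrippedThreadTwoN)
    (hS2 : ∀ p : ℕ, p.Prime → NoEternalStrippedRadicandChain p 2)
    (hS3 : ∀ p : ℕ, p.Prime → NoEternalStrippedRadicandChain p 3)
    (hLow : Literature.AlgebraicGeometry.Resolution.Lipman1978ValuativeQuadraticSequence.{0} → LowOrderTailConclTwoN)
    (hL : Literature.AlgebraicGeometry.Resolution.Lipman1978NoEternalNormalBranch.{0})
    (hLV : Literature.AlgebraicGeometry.Resolution.Lipman1978ValuativeQuadraticSequence.{0})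
    (hCP' : Literature.AlgebraicGeometry.Resolution.CossartPiltant2019LocalPermissible.{0}) : EternalSteeredRunTwo :=
  eternalSteeredRunTwo_of_normalised_split_debts (normalisedStartTwo_of_normalAtGenerator hN1)
    (pointTailHighConclTwo_of_B4 hB4)
    (highWanderConclTwoN_of_heightSplit_debts hS hB₂ hC₂ hA3 hTi hH hL hCP' hS2 hS3) (hLow hLV) hL
    (_root_.Summit.ResolutionOfSingularities.ResolutionOfSingularities.Theorems.SwitchingDichotomy.HironakaLUBranchOfCP.hironakaLUIsolatedBranch_of_localPermissible hCP')

/-- **THE T-LINE OF RECORD AFTER §σ2.25 v2, (N1) DISCHARGED** (r28's `normalAtGeneratorTwo_holds`). Pure logic. OURS. [folklore] -/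
theorem eternalSteeredRunTwo_of_slate2' (hB4 : NoHeightOneCarrierTwo)
    (hTi : FinitelyHitThreadTwoN) (hH : HitHeightLtTwoN)
    (hS : StrippingTailHighConclTwoN) (hB₂ : BirthWanderHighConclTwoN) (hC₂ : BranchWanderHighConclTwoN)
    (hA3 : StrippedThreadTwoN)
    (hS2 : ∀ p : ℕ, p.Prime → NoEternalStrippedRadicandChain p 2)
    (hS3 : ∀ p : ℕ, p.Prime → NoEternalStrippedRadicandChain p 3)
    (hLow : Literature.AlgebraicGeometry.Resolution.Lipman1978ValuativeQuadraticSequence.{0} → LowOrderTailConclTwoN)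
    (hL : Literature.AlgebraicGeometry.Resolution.Lipman1978NoEternalNormalBranch.{0})
    (hLV : Literature.AlgebraicGeometry.Resolution.Lipman1978ValuativeQuadraticSequence.{0})
    (hCP' : Literature.AlgebraicGeometry.Resolution.CossartPiltant2019LocalPermissible.{0}) : EternalSteeredRunTwo :=
  eternalSteeredRunTwo_of_slate2 normalAtGeneratorTwo_holds hB4 hTi hH hS hB₂ hC₂ hA3 hS2 hS3 hLow hL hLV hCP'

/-- **THE T-LINE OF RECORD AFTER §σ2.25 v2.1 ON r30** (plan-1 RULING 33b; r30's `eternalSteeredRunTwo_of_slate_low''` with `(hB) (hC)` replaced by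
`(hS) (hB₂) (hC₂) (hA3) (hS2) (hS3)` — PT₁ ∩ HIGH (B4), (N1) and 026's reduction DISCHARGED, LOW unfolded): T ⇐ T-i `FinitelyHitThreadTwoN` · Θ2
`HitHeightLtTwoN` · **F-B ∧ F-A1 ∧ F-A2 (FRONTIER)** · F-A3 (funnel) · K♭(2) (debt → Lipman (A)) · **K♭(3) (FRONTIER)** · `step` (`lowOrder_step_two`) ·
D3 `LowRunTamedMixedBranchTwo` · the named facts Lipman 1978 (branch + valuative) and Cossart–Piltant 2019 (printed shape). Pure logic. OURS. [folklore] -/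
theorem eternalSteeredRunTwo_of_slate3 (hTi : FinitelyHitThreadTwoN) (hH : HitHeightLtTwoN)
    (hS : StrippingTailHighConclTwoN) (hB₂ : BirthWanderHighConclTwoN) (hC₂ : BranchWanderHighConclTwoN)
    (hA3 : StrippedThreadTwoN)
    (hS2 : ∀ p : ℕ, p.Prime → NoEternalStrippedRadicandChain p 2)
    (hS3 : ∀ p : ℕ, p.Prime → NoEternalStrippedRadicandChain p 3)
    (step : ∀ p : ℕ, p = 2 →
      ∀ (k K : Type) [Field k] [CharP k p] [PerfectField k] [Field K] [Algebra k K]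
      (O : ValuationSubring K) (A₀ : Subalgebra k K) (h₀ : A₀.toSubring ≤ O.toSubring) (t : K),
      CoreDatum p 4 k K O A₀ h₀ t →
      ∀ (R : ℕ → Subring K) (P : (i : ℕ) → Ideal (R i)) (s : ℕ → K),
        R 0 = locAtCentre A₀.toSubring O → IsSteeredRun O R P t p s →
        ∀ i, ¬ IsHighOrderAt R s p i → ¬ IsHighOrderAt R s p (i + 1))
    (hD3 : LowRunTamedMixedBranchTwo)
    (hL : Literature.AlgebraicGeometry.Resolution.Lipman1978NoEternalNormalBranch.{0})
    (hLV : Literature.AlgebraicGeometry.Resolution.Lipman1978ValuativeQuadraticSequence.{0})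
    (hCP' : Literature.AlgebraicGeometry.Resolution.CossartPiltant2019LocalPermissible.{0}) : EternalSteeredRunTwo :=
  eternalSteeredRunTwo_of_slate2 normalAtGeneratorTwo_holds noHeightOneCarrierTwo_holds hTi hH hS hB₂ hC₂ hA3 hS2 hS3
    (lowOrderTailConclTwoN_of_lipman step hD3 tamedMixedBranchReduction_holds) hL hLV hCP'

/-- **THE T-LINE OF RECORD (r31)** — every dischargeable binder discharged by a leaf of record (N1 `normalAtGeneratorTwo_holds`, B4
`noHeightOneCarrierTwo_holds`, Θ2 `hitHeightLtTwoN_holds`, `step` `lowOrderStep_holds`, duals `membersDualDerivationsTwoN_holds`, B7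
`rankFourExitTwo_holds`, 026 `tamedMixedBranchReduction_holds`): T ⇐ T-i `FinitelyHitThreadTwoN` · **F-B ∧ F-A1 ∧ F-A2 (FRONTIER)** · F-A3
`StrippedThreadTwoN` (funnel, pv-003) · K♭(2) (debt → Lipman (A), 038 + pv-014) · **K♭(3) (FRONTIER)** · C8 `LowSurfaceStepExitsTwo` (072) · D3a
`LowTowerExistsTwo` (pv-012) · D3b′ `LowTowerPointStepsIOTwo` (pv-007) · D3c `LowTowerTamingTwo` (062) · D3d `LowTowerSingularTwo` (stub-3) · the
named facts Lipman 1978 (branch + valuative) and Cossart–Piltant 2019 (printed shape). Pure logic. OURS. [folklore] -/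
theorem eternalSteeredRunTwo_of_slate4 (hTi : FinitelyHitThreadTwoN)
    (hS : StrippingTailHighConclTwoN) (hB₂ : BirthWanderHighConclTwoN) (hC₂ : BranchWanderHighConclTwoN)
    (hA3 : StrippedThreadTwoN)
    (hS2 : ∀ p : ℕ, p.Prime → NoEternalStrippedRadicandChain p 2)
    (hS3 : ∀ p : ℕ, p.Prime → NoEternalStrippedRadicandChain p 3)
    (hC8 : LowSurfaceStepExitsTwo) (hD3a : LowTowerExistsTwo) (hD3b : LowTowerPointStepsIOTwo)
    (hD3c : LowTowerTamingTwo) (hD3d : LowTowerSingularTwo)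
    (hL : Literature.AlgebraicGeometry.Resolution.Lipman1978NoEternalNormalBranch.{0})
    (hLV : Literature.AlgebraicGeometry.Resolution.Lipman1978ValuativeQuadraticSequence.{0})
    (hCP' : Literature.AlgebraicGeometry.Resolution.CossartPiltant2019LocalPermissible.{0}) : EternalSteeredRunTwo :=
  eternalSteeredRunTwo_of_slate3 hTi hitHeightLtTwoN_holds hS hB₂ hC₂ hA3 hS2 hS3 lowOrderStep_holds
    (lowRunTamedMixedBranchTwo_of_pieces' hC8 hD3a hD3b hD3c hD3d) hL hLV hCP'

/-- **THE T-LINE OF RECORD (r32)** — T-i `finitelyHitThreadTwoN_holds` (res-D-pv-011), C8, D3b′, D3d discharged on top of r31's leaves: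
T ⇐ **F-B ∧ F-A1 ∧ F-A2 (FRONTIER)** · F-A3 `StrippedThreadTwoN` (funnel, pv-003) · K♭(2) (debt → Lipman (A), 038 + pv-014) · **K♭(3)
(FRONTIER)** · D3a `LowTowerExistsTwo` (pv-012) · D3c `LowTowerTamingTwo` (062) · the named facts Lipman 1978 (branch + valuative) and
Cossart–Piltant 2019 (printed shape). Pure logic. OURS. [folklore] -/
theorem eternalSteeredRunTwo_of_slate5
    (hS : StrippingTailHighConclTwoN) (hB₂ : BirthWanderHighConclTwoN) (hC₂ : BranchWanderHighConclTwoN)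
    (hA3 : StrippedThreadTwoN)
    (hS2 : ∀ p : ℕ, p.Prime → NoEternalStrippedRadicandChain p 2)
    (hS3 : ∀ p : ℕ, p.Prime → NoEternalStrippedRadicandChain p 3)
    (hD3a : LowTowerExistsTwo) (hD3c : LowTowerTamingTwo)
    (hL : Literature.AlgebraicGeometry.Resolution.Lipman1978NoEternalNormalBranch.{0})
    (hLV : Literature.AlgebraicGeometry.Resolution.Lipman1978ValuativeQuadraticSequence.{0})
    (hCP' : Literature.AlgebraicGeometry.Resolution.CossartPiltant2019LocalPermissible.{0}) : EternalSteeredRunTwo :=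
  eternalSteeredRunTwo_of_slate4 finitelyHitThreadTwoN_holds hS hB₂ hC₂ hA3 hS2 hS3 lowSurfaceStepExitsTwo_holds hD3a
    lowTowerPointStepsIOTwo_holds hD3c lowTowerSingularTwo_holds hL hLV hCP'

/-- **K♭(2) HOLDS modulo Lipman (A)** (adoption leaf over res-D-pv-014's `StrippedChainTwo.noEternalStrippedRadicandChain_two` p521063 / p520099,
over res-type-038's `Lipman1978NoEternalNormalisedBranch` p518801 / p519358; plan-1 RULING 68). OURS. [folklore] -/
theorem noEternalStrippedRadicandChain_two_of_lipmanNormalised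
    (hL' : Literature.AlgebraicGeometry.Resolution.Lipman1978NoEternalNormalisedBranch.{0}) :
    ∀ p : ℕ, p.Prime → NoEternalStrippedRadicandChain p 2 :=
  fun p hp => _root_.Summit.ResolutionOfSingularities.ResolutionOfSingularities.Theorems.SwitchingDichotomy.StrippedChainTwo.noEternalStrippedRadicandChain_two hL' p hp

/-- **THE T-LINE OF RECORD (r33)** — hS2 discharged (pv-014) and the LIPMAN TRUST BASE collapsed to the ONE printed fact (A)
`Lipman1978NoEternalNormalisedBranch` (plan-1 RULING 71: `hL := hL'.toNormalBranch`, `hLV := hL'.toValuativeQuadraticSequence`, res-type-038 p519358 / p521706):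
T ⇐ **F-B ∧ F-A1 ∧ F-A2 (FRONTIER)** · F-A3 `StrippedThreadTwoN` (Θ1♭ packaging, pv-003 / pv-007) · **K♭(3) (FRONTIER; §σ2.26 reduction pending)** ·
D3a `LowTowerExistsTwo` (pv-012) · D3c `LowTowerTamingTwo` (062) · FACTS {Lipman 1978 (A), Cossart–Piltant 2019 (printed shape)}. Pure logic. OURS. [folklore] -/
theorem eternalSteeredRunTwo_of_slate6
    (hS : StrippingTailHighConclTwoN) (hB₂ : BirthWanderHighConclTwoN) (hC₂ : BranchWanderHighConclTwoN)
    (hA3 : StrippedThreadTwoN)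
    (hS3 : ∀ p : ℕ, p.Prime → NoEternalStrippedRadicandChain p 3)
    (hD3a : LowTowerExistsTwo) (hD3c : LowTowerTamingTwo)
    (hL' : Literature.AlgebraicGeometry.Resolution.Lipman1978NoEternalNormalisedBranch.{0})
    (hCP' : Literature.AlgebraicGeometry.Resolution.CossartPiltant2019LocalPermissible.{0}) : EternalSteeredRunTwo :=
  eternalSteeredRunTwo_of_slate5 hS hB₂ hC₂ hA3 (noEternalStrippedRadicandChain_two_of_lipmanNormalised hL') hS3 hD3a hD3c
    hL'.toNormalBranch hL'.toValuativeQuadraticSequence hCP'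

end SteeredTwo

end Summit.ResolutionOfSingularities.ResolutionOfSingularities.Theorems.SwitchingDichotomy.Words
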